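import Summits.QuantumFields.YangMills.Theorems.BalabanUVNodesN22KnitVertexCentered

/-!
# BalabanUVNodes ∕ N22 knit, THE VERTEX WITNESS — at order `p = 1` (sections approaching their vertex value only LINEARLY along (2.9)'s
# relative discs) oscillation fading (O) + analyticity do NOT give fading memory, EVEN WITH NO GROWTH (`μ = 1`): an explicit functional on
# explicit carriers with (P), (O) at rate `θ = 1∕2`, the centred relative-disc letter of `BalabanUVNodesN22KnitVertexCentered` at `p = 1`, and NO
# `NE9 ∧ FadingMemory` with any `ω < 1` — so the hypothesis `p ≥ 2` of `…VertexCentered` (rate `θ^{1−1∕p}μ^{1∕p}`) cannot be lowered to `p = 1`,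
# and pv10's linear weight (`ne9_of_couplingAnalyticRelLin`: bounded, non-fading moduli) is sharp also in the presence of (O)
# (Track A, DAG node N22 = NE9; cluster K4 «SpineRates»; seat `pub-ymgap-dag-n22-a`)

HONEST FRAMING.  A kernel witness on TOY carriers (domains `ℕ` with scale `X + 1`, no background, `κ = 0`); nothing of Bałaban's is modelled or
asserted; count-neutral; NOT a node discharge and NOT a refutation of N22 (the node's statement is about the carriers OF RECORD).  0 `sorry`,
0 `def`, standard axioms.  `--supports` item `SpineGivenEndpoint` (route «BalabanUVNodes», cluster K4).

THE WITNESS.  `E g U X = 2^{−X}·ψ(2^{X}·g₀)`, `ψ(u) = u∕(1+u)`: the term of scale `X + 1` reads ONLY the oldest coupling `g₀`, through a saturating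
profile at the scale `2^{−X}`.  (P) holds (only `g₀`, index `0 < X + 1`); (O) holds with `C₀ = 1`, `θ = 1∕2` (`0 ≤ ψ < 1`); the CENTRED linear
letter holds with `c = 1∕2`, `μ = 1`, `M = 2`: in `g₀` the complex section `z ↦ 2^{−X}·2^{X}z∕(1 + 2^{X}z)` is analytic on `Re z > 0 ⊇ D̄(t, t∕2)` with
`‖F(z) − 0‖ ≤ ‖z‖ ≤ 2t`, and in every other young coupling the section is CONSTANT (vertex value = itself, bound `0`).  Yet at `X = n` the
histories `g ≡ 2^{−n}` and `g[0 ↦ 2^{−n−1}]` give `|ΔE| = 2^{−n}(ψ(1) − ψ(1∕2)) = 2^{−n}∕6` against `|Δg₀| = 2^{−n−1}`: any NE9 modulus has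
`Λ (n+1) 0 ≥ 1∕3` for EVERY `n` — no `C₉·ω^{n+1}` with `ω < 1` dominates it.  READING (census `N22-ROADS-CENSUS.md` v1.3): near the vertex the
difference quotient from the vertex value must ITSELF decay in the age (`…KnitVertex` §4's letter, or order `p ≥ 2` with `θ^{p−1}μ < 1`);
(O) cannot supply that decay through a linearly vanishing analytic bound.

References (TYPES only): [Balaban1987RG1] = T. Bałaban, Commun. Math. Phys. **109** (1987) 249–301 — (2.9) p. 266, (2.13) p. 268;
`T4CouplingAnalyticity` §§9–10 (pv10's vertex analysis).
-/

noncomputable section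

namespace Summit.QuantumFields.YangMills.BalabanUVNodes.N22KnitVertexWitness

open Set Metric Complex Real Filter Finset
open scoped Real Topology BigOperators
open Literature.MathematicalPhysics.QuantumFieldTheory.Balaban1983to89
open Literature.MathematicalPhysics.QuantumFieldTheory.Balaban1983to89.T4OutputRate

/-- The saturating profile `ψ(u) = u∕(1+u)` on `u ≥ 0`: values in `[0, 1)`. [folklore] -/
theorem profile_mem {u : ℝ} (hu : 0 ≤ u) : 0 ≤ u / (1 + u) ∧ u / (1 + u) < 1 := by
  have h1 : 0 < 1 + u := by linarith
  exact ⟨div_nonneg hu h1.le, (div_lt_one h1).mpr (by linarith)⟩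

/-- On the closed right half-plane the complex profile is `1`-Lipschitz from the origin: `‖z∕(1+z)‖ ≤ ‖z‖` and `1 + z ≠ 0` for `0 ≤ Re z`. [folklore] -/
theorem profile_norm_le {z : ℂ} (hz : 0 ≤ z.re) : (1 : ℂ) + z ≠ 0 ∧ ‖z / (1 + z)‖ ≤ ‖z‖ := by
  have hre : 1 ≤ ((1 : ℂ) + z).re := by simp; linarith
  have hnorm : 1 ≤ ‖(1 : ℂ) + z‖ := hre.trans (Complex.re_le_norm _)
  have hne : (1 : ℂ) + z ≠ 0 := fun h => by rw [h, norm_zero] at hnorm; linarith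
  refine ⟨hne, ?_⟩
  rw [norm_div]
  exact div_le_self (norm_nonneg _) hnorm

/-- **THE VERTEX WITNESS.**  On the toy carriers (domains `ℕ`, scale `X + 1`, tree length `0`, trivial backgrounds) the functional
`E g U X = 2^{−X}·(2^{X}g₀)∕(1 + 2^{X}g₀)` has (P) prefix dependence on `Window 1`, (O) oscillation fading with `C₀ = 1` at the rate `θ = 1∕2`,
and the CENTRED relative-disc letter of `BalabanUVNodesN22KnitVertexCentered` at ORDER `p = 1` with `c = 1∕2`, `M = 2`, growth `μ = 1` — and
nevertheless NO history moduli `Λ` with `NE9 E (Window 1) 0 Λ ∧ FadingMemory C₉ ω Λ` for any `0 ≤ ω < 1`.  Hence `p ≥ 2` in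
`ne9_and_fadingMemory_of_osc_analyticRelPowCentered` cannot be lowered to `p = 1`. [folklore] -/
theorem exists_centredLinear_osc_not_fading :
    ∃ E : Functional ⟨ℕ, fun X => X + 1, fun _ => 0, fun _ => le_rfl, Unit, Unit, fun _ _ => 0, fun _ _ => le_rfl, id⟩ Unit,
      PrefixDependenceOn E (Window 1) ∧
      (∀ g ∈ Window 1, ∀ g' ∈ Window 1, ∀ (U : Unit) (X : ℕ) (a : ℕ), a ≤ X + 1 →
        (∀ n, a ≤ n → g n = g' n) → |E g U X - E g' U X| ≤ 1 * (1 / 2 : ℝ) ^ (X + 1 - a) * Real.exp (-(0 * (0 : ℝ)))) ∧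
      (∀ g ∈ Window 1, ∀ (U : Unit) (X : ℕ) (i : ℕ), i < X + 1 → ∃ (F : ℂ → ℂ) (D : Set ℂ) (e₀ : ℂ),
        DifferentiableOn ℂ F D ∧ (∀ t ∈ Ioc (0 : ℝ) 1, closedBall (t : ℂ) (1 / 2 * t) ⊆ D) ∧
        (∀ t ∈ Ioc (0 : ℝ) 1, ∀ z ∈ closedBall (t : ℂ) (1 / 2 * t),
          ‖F z - e₀‖ ≤ 2 * (1 : ℝ) ^ (X + 1 - 1 - i) * t ^ 1 * Real.exp (-(0 * (0 : ℝ)))) ∧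
        (∀ t ∈ Ioc (0 : ℝ) 1, F t = (E (Function.update g i t) U X : ℂ))) ∧
      ∀ (C₉ ω : ℝ) (Λ : ℕ → ℕ → ℝ), 0 ≤ ω → ω < 1 → FadingMemory C₉ ω Λ → ¬ NE9 E (Window 1) 0 Λ := by
  refine ⟨fun g _ X => (1 / 2 : ℝ) ^ X * ((2 : ℝ) ^ X * g 0 / (1 + (2 : ℝ) ^ X * g 0)), ?_, ?_, ?_, ?_⟩
  · -- (P): only `g 0` is read, and `0 < X + 1`
    intro g _ g' _ U X hagree
    have h0 : g 0 = g' 0 := hagree 0 (Nat.succ_pos X)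
    simp [h0]
  · -- (O): `|ΔE| ≤ 2^{−X} ≤ (1/2)^{X+1−a}` for `a ≥ 1`; equality of histories for `a = 0`
    intro g hg g' hg' U X a ha hagree
    rw [mul_zero, neg_zero, Real.exp_zero, mul_one, one_mul]
    rcases Nat.eq_zero_or_pos a with rfl | hapos
    · have hgg : g = g' := funext fun n => hagree n (Nat.zero_le n)
      subst hgg
      simp
    · have hψ : ∀ h : ℕ → ℝ, h ∈ Window 1 → 0 ≤ (2 : ℝ) ^ X * h 0 / (1 + (2 : ℝ) ^ X * h 0) ∧
          (2 : ℝ) ^ X * h 0 / (1 + (2 : ℝ) ^ X * h 0) < 1 :=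
        fun h hh => profile_mem (mul_nonneg (pow_nonneg zero_le_two X) (hh 0).1.le)
      obtain ⟨h1, h2⟩ := hψ g hg
      obtain ⟨h3, h4⟩ := hψ g' hg'
      have hpow : (1 / 2 : ℝ) ^ X ≤ (1 / 2 : ℝ) ^ (X + 1 - a) :=
        pow_le_pow_of_le_one (by norm_num) (by norm_num) (by omega)
      have hhalf : 0 ≤ (1 / 2 : ℝ) ^ X := pow_nonneg (by norm_num) X
      rw [← mul_sub, abs_mul, abs_of_nonneg hhalf]
      calc (1 / 2 : ℝ) ^ X * |(2 : ℝ) ^ X * g 0 / (1 + (2 : ℝ) ^ X * g 0) - (2 : ℝ) ^ X * g' 0 / (1 + (2 : ℝ) ^ X * g' 0)|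
          ≤ (1 / 2 : ℝ) ^ X * 1 := by
            refine mul_le_mul_of_nonneg_left (abs_le.mpr ⟨by linarith, by linarith⟩) hhalf
        _ ≤ (1 / 2 : ℝ) ^ (X + 1 - a) := by rw [mul_one]; exact hpow
  · -- the centred linear relative-disc letter (`p = 1`, `c = 1/2`, `M = 2`, `μ = 1`)
    intro g hg U X i hi
    rw [mul_zero, neg_zero, Real.exp_zero]
    rcases Nat.eq_zero_or_pos i with rfl | hipos
    · -- the coupling `g 0`: `F z = 2^{−X}·2^{X}z/(1 + 2^{X}z)` on the right half-plane, vertex value `0`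
      set a₁ : ℝ := (1 / 2 : ℝ) ^ X with ha₁
      set a₂ : ℝ := (2 : ℝ) ^ X with ha₂
      have ha₁0 : 0 ≤ a₁ := pow_nonneg (by norm_num) X
      have ha₂0 : 0 ≤ a₂ := pow_nonneg zero_le_two X
      have ha₁₂ : a₁ * a₂ = 1 := by rw [ha₁, ha₂, ← mul_pow]; norm_num
      have hre2 : ∀ z : ℂ, ((a₂ : ℂ) * z).re = a₂ * z.re := fun z => Complex.re_ofReal_mul a₂ z
      refine ⟨fun z => (a₁ : ℂ) * ((a₂ : ℂ) * z / (1 + (a₂ : ℂ) * z)), {z | 0 < z.re}, 0, ?_, ?_, ?_, ?_⟩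
      · intro z hz
        have hz' : 0 ≤ ((a₂ : ℂ) * z).re := by rw [hre2]; exact mul_nonneg ha₂0 (le_of_lt hz)
        have hne := (profile_norm_le hz').1
        have h1 : DifferentiableAt ℂ (fun y : ℂ => (a₂ : ℂ) * y) z := differentiableAt_id.const_mul _
        have h2 : DifferentiableAt ℂ (fun y : ℂ => 1 + (a₂ : ℂ) * y) z := h1.const_add 1
        exact ((h1.div h2 hne).const_mul (a₁ : ℂ)).differentiableWithinAt
      · intro t ht z hz
        rw [mem_closedBall, dist_eq_norm] at hz
        show 0 < z.re
        have h1 : |(z - (t : ℂ)).re| ≤ 1 / 2 * t := (Complex.abs_re_le_norm _).trans hz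
        rw [Complex.sub_re, Complex.ofReal_re] at h1
        have := (abs_le.mp h1).1
        linarith [ht.1]
      · intro t ht z hz
        rw [mem_closedBall, dist_eq_norm] at hz
        have hzre : 0 < z.re := by
          have h1 : |(z - (t : ℂ)).re| ≤ 1 / 2 * t := (Complex.abs_re_le_norm _).trans hz
          rw [Complex.sub_re, Complex.ofReal_re] at h1
          have := (abs_le.mp h1).1
          linarith [ht.1]
        have hz' : 0 ≤ ((a₂ : ℂ) * z).re := by rw [hre2]; exact mul_nonneg ha₂0 hzre.le
        have hprof := (profile_norm_le hz').2
        have hnormz : ‖z‖ ≤ 3 / 2 * t := by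
          calc ‖z‖ ≤ ‖z - (t : ℂ)‖ + ‖((t : ℝ) : ℂ)‖ := norm_le_norm_sub_add _ _
            _ ≤ 1 / 2 * t + t := add_le_add hz (by rw [Complex.norm_real, Real.norm_of_nonneg ht.1.le])
            _ = 3 / 2 * t := by ring
        rw [sub_zero, norm_mul, Complex.norm_real, Real.norm_of_nonneg ha₁0, one_pow, mul_one, pow_one, mul_one]
        calc a₁ * ‖(a₂ : ℂ) * z / (1 + (a₂ : ℂ) * z)‖ ≤ a₁ * ‖(a₂ : ℂ) * z‖ := mul_le_mul_of_nonneg_left hprof ha₁0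
          _ = ‖z‖ := by rw [norm_mul, Complex.norm_real, Real.norm_of_nonneg ha₂0, ← mul_assoc, ha₁₂, one_mul]
          _ ≤ 2 * t := by linarith [ht.1]
      · intro t ht
        simp only [Function.update_self]
        push_cast
        rw [ha₁, ha₂]
        push_cast
        ring
    · -- another young coupling `i ≥ 1`: the section is CONSTANT; vertex value = itself, bound `0`
      refine ⟨fun _ => ((1 / 2 : ℝ) ^ X * ((2 : ℝ) ^ X * g 0 / (1 + (2 : ℝ) ^ X * g 0)) : ℂ), univ,
        ((1 / 2 : ℝ) ^ X * ((2 : ℝ) ^ X * g 0 / (1 + (2 : ℝ) ^ X * g 0)) : ℂ), differentiableOn_const _, fun _ _ => subset_univ _,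
        fun t ht z _ => ?_, fun t ht => ?_⟩
      · rw [sub_self, norm_zero]
        have : 0 ≤ t := ht.1.le
        positivity
      · have hi0 : (0 : ℕ) ≠ i := by omega
        simp [Function.update_of_ne hi0]
  · -- NO fading moduli: at `X = n`, `Λ (n+1) 0 ≥ 1/3` for every `n`
    intro C₉ ω Λ hω0 hω1 hF h9
    have hC₉ : 0 ≤ C₉ := by have h := hF 0 0 le_rfl; simpa using h.1.trans h.2
    -- choose `n` with `C₉ ω^n < 1/3`
    obtain ⟨n, hn⟩ : ∃ n : ℕ, ω ^ n < 1 / (3 * (C₉ + 1)) := exists_pow_lt_of_lt_one (by positivity) hω1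
    have hωn1 : C₉ * ω ^ (n + 1) < 1 / 3 := by
      have h1 : ω ^ (n + 1) ≤ ω ^ n := by rw [pow_succ]; exact mul_le_of_le_one_right (pow_nonneg hω0 n) hω1.le
      have h2 : C₉ * ω ^ (n + 1) ≤ C₉ * ω ^ n := mul_le_mul_of_nonneg_left h1 hC₉
      have h3 : C₉ * ω ^ n ≤ C₉ * (1 / (3 * (C₉ + 1))) := mul_le_mul_of_nonneg_left hn.le hC₉
      have h4 : C₉ * (1 / (3 * (C₉ + 1))) < 1 / 3 := by
        rw [mul_one_div, div_lt_div_iff₀ (by positivity) (by norm_num)]; nlinarith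
      linarith
    -- the two histories at the vertex scale `t = 2^{−n}`
    set t : ℝ := (1 / 2 : ℝ) ^ n with htdef
    have ht0 : 0 < t := pow_pos (by norm_num) n
    have ht1 : t ≤ 1 := pow_le_one₀ (by norm_num) (by norm_num)
    have hg : (fun _ : ℕ => t) ∈ Window 1 := fun _ => ⟨ht0, ht1⟩
    have hg' : Function.update (fun _ : ℕ => t) 0 (t / 2) ∈ Window 1 :=
      T4CouplingAnalyticity.update_mem_boxWindow (I := Set.Ioc (0 : ℝ) 1) hg 0 ⟨by positivity, by linarith⟩
    have h := h9 _ hg _ hg' () n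
    -- evaluate both sides
    have h2n : (2 : ℝ) ^ n * t = 1 := by rw [htdef, ← mul_pow]; norm_num
    have hL : (1 / 2 : ℝ) ^ n * ((2 : ℝ) ^ n * t / (1 + (2 : ℝ) ^ n * t)) -
        (1 / 2 : ℝ) ^ n * ((2 : ℝ) ^ n * (t / 2) / (1 + (2 : ℝ) ^ n * (t / 2))) = t / 6 := by
      rw [show (2 : ℝ) ^ n * (t / 2) = 1 / 2 by rw [← mul_div_assoc, h2n], h2n, ← htdef]
      norm_num; ring
    have hsum : ∑ i ∈ Finset.range (n + 1), Λ (n + 1) i * |(fun _ : ℕ => t) i - Function.update (fun _ : ℕ => t) 0 (t / 2) i|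
        = Λ (n + 1) 0 * (t / 2) := by
      rw [Finset.sum_eq_single_of_mem 0 (Finset.mem_range.2 (Nat.succ_pos n)) fun j _ hj => by
        rw [Function.update_of_ne hj, sub_self, abs_zero, mul_zero]]
      rw [Function.update_self, show t - t / 2 = t / 2 by ring, abs_of_pos (by positivity)]
    have hE : |(1 / 2 : ℝ) ^ n * ((2 : ℝ) ^ n * (fun _ : ℕ => t) 0 / (1 + (2 : ℝ) ^ n * (fun _ : ℕ => t) 0)) -
        (1 / 2 : ℝ) ^ n * ((2 : ℝ) ^ n * Function.update (fun _ : ℕ => t) 0 (t / 2) 0 /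
          (1 + (2 : ℝ) ^ n * Function.update (fun _ : ℕ => t) 0 (t / 2) 0))| = t / 6 := by
      simp only [Function.update_self]
      rw [hL, abs_of_pos (by positivity)]
    have h' : t / 6 ≤ Real.exp (-(0 * (0 : ℝ))) * (Λ (n + 1) 0 * (t / 2)) := by
      rw [← hE, ← hsum]; exact h
    rw [mul_zero, neg_zero, Real.exp_zero, one_mul] at h'
    have hΛ : 1 / 3 ≤ Λ (n + 1) 0 := by nlinarith
    have hΛ' : Λ (n + 1) 0 ≤ C₉ * ω ^ (n + 1 - 0) := (hF (n + 1) 0 (Nat.zero_le _)).2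
    rw [Nat.sub_zero] at hΛ'
    linarith

end Summit.QuantumFields.YangMills.BalabanUVNodes.N22KnitVertexWitness

end
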